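import Literature.IUT.HodgeArakelov.ThetaEvaluationSettingProofs3
import Literature.IUT.HodgeTheaters.TemperedCoveringsCor23iiiProofs

/-!
# [IUTchII] Prop. 2.2 (i)′: the input `Π_{v•}·Δ = Π_v` supplied by [IUTchI] Cor. 2.3 (iii) (bridge, proof-only)

Proof-only companion (abc-iut cell, D-0068 wave 5, seat abc-iut-w5-d086; cone of [IUTchIII] Cor. 3.12, DAG node
**IUTchII:Prop2.2(i)**; plan/GAP-LEDGER.md row G-w4d010-1 and its disposition rows). No definition, no new named
fact; the audited modules `ThetaEvaluationSetting*.lean` (abc-iut-L6-t1, abc-iut-w4-d010) and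
`TemperedCoverings*.lean` (abc-iut-L5-t1, abc-iut-w4-d058) are imported unchanged. Nothing here takes a side on
[IUTchIII] Cor. 3.12 (claim key `Mochizuki2012`, DISPUTED, D-0012); typed ≠ proved.

S. Mochizuki, *Inter-universal Teichmüller theory II*, kurims manuscript (Dec. 2020) §2, Prop. 2.2 p. 66:
"`Π_{v•} ⊆ Π_{v▶} ⊆ Π_v` … the decomposition groups determined, respectively, by the subgraphs `Γ•_X` and `Γ▶_X` —
i.e., more precisely, the group “`Π^tp_{X,ℍ}`” of [IUTchI], Corollary 2.3, (iii)". *Inter-universal Teichmüller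
theory I*, kurims manuscript (May 2020) §2, Cor. 2.3 (iii) p. 47: "natural exact sequences of center-free
topological groups `1 → Δ^tp_{X,ℍ} → Π^tp_{X,ℍ} → G_k → 1` … where `Π^tp_{X,ℍ}`, `Π̂_{X,ℍ}` are defined so as to
render the sequences exact".

THE RESIDUAL. abc-iut-w4-d010's `prop22_i'_of_groupTheoretic` (ThetaEvaluationSettingProofs3.lean) derives the
repaired node predicate `Prop22_i'` from three inputs; the third, `hsurj` — "along one identification
`e₀ : Π_v ≅ Π^tp_{X̲̲_v}`, every element of `Π_v` is congruent modulo `Δ = Ker(Π_v ≅ Π_X(M^Θ(Π_v)) ↠ G)` to an element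
of `e₀⁻¹Π^tp_{X,Γ•}`", i.e. `Π_{v•}·Δ = Π_v` — was recorded on plan/GAP-LEDGER.md as the residual (SJ) of
G-w4d010-1. In print (SJ) is the EXACTNESS AT `G_k` of Cor. 2.3 (iii) at `ℍ := Γ•_X`, and in layer L5 it is PROVED:
`Literature.IUT.HodgeTheaters.StableCurveTemperedData.piTpXH_surjective_of_outer` (TemperedCoveringsCor23iiiProofs,
p411765: `Π^tp_{X,ℍ} = N_{Π^tp_X}(Δ^tp_{X,ℍ})` surjects onto `G_k` as soon as the outer `G_k`-action descends to
`Δ^tp_{X,ℍ}`, i.e. `ℍ` is `G_k`-stable — no slimness needed), resp. the second conjunct of the typed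
`StableCurveTemperedData.Cor23iii.exact_tp`. This file is the BRIDGE over IDENTIFICATION DATA ONLY (the shape of
abc-iut-w4-d034's `TemperedCoveringsCharacteristic.lean` for G-w4d010-3), i.e. exactly what the pending MERGE-MAP
row "[IUTchII] Prop 2.2 reference pair ↔ [IUTchI] Cor 2.3 (iii) decomposition groups" (abc-iut-L6-t7; TODO-merge
abc-iut-L5-t1 / abc-iut-L6-t1 of `ThetaEvaluationSettingR.SubgraphReference`) will instantiate:

* an isomorphism of topological groups `j : Π^tp_X ≅ Π^tp_{X̲̲_v}` from the L5 datum `C : StableCurveTemperedData`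
  (the curve and sub-semi-graph `ℍ = Γ•_X` of Prop. 2.2) onto the reference group of the `BadPlaceSetting`, carrying
  `Π^tp_{X,ℍ}` (`C.piTpXH`) onto the reference decomposition group `Π^tp_{X,Γ•}` (`R.refBullet`);
* the statement that, along an identification `e₀ : Π_v ≅ Π^tp_{X̲̲_v}`, the two Galois quotients have THE SAME
  KERNEL: `Δ = Ker(Π_v ≅ Π_X(M^Θ(Π_v)) ↠ G)` (the `Δ` of `PointedInversion`) corresponds to `Δ^tp_X = Ker(Π^tp_X ↠ G_k)`.

Results (all in `namespace Literature.IUT.HodgeArakelov`):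
* `SubgraphReference.exists_mem_refBullet_of_piTpXH_surjective` — (SJ) from the SURJECTIVITY `Π^tp_{X,ℍ} ↠ G_k`;
* `SubgraphReference.exists_mem_refBullet_of_outer` — (SJ) from the outer-descent hypothesis of Cor. 2.3 (i)
  ("ℍ is stabilized by the natural action of `G_k`", [IUTchI] p. 47), via `piTpXH_surjective_of_outer`;
* `SubgraphReference.exists_mem_refBullet_of_cor23iii` — (SJ) from the typed `Cor23iii` (+ its hypothesis (a)/(b));
* `prop22_i'_of_cor23iii_bridge` / `prop22_i'_of_outer_bridge` — **IUTchII:Prop2.2(i)′ HOLDS** given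
  `R.GroupTheoretic` ([SemiAnbd] Cor. 3.11 input), `Π_Ÿ(Π_v) ⊴ Π_v`, and [IUTchI] Cor. 2.3 (iii) through the
  identification data — the GAP-LEDGER residual (SJ) is thereby CLOSED MODULO THE MERGE IDENTIFICATION (no printed
  input missing, no FACT-LIST request).

Deliberately NOT here: the construction of `C`, `j`, `e₀` for the genuine `X̲̲_v` (the merge itself), the
`G_k`-stability of `Γ•_X` at the model ([IUTchII] Rmk. 2.1.1 (ii): `Γ•_X` is `ι_X`-intrinsic), anything on (ii).
-/

namespace Literature.IUT.HodgeArakelov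

universe u

open Literature.IUT.HodgeTheaters
open scoped Pointwise

variable {S : BadPlaceSetting.{u}} {P : TopGroup.{u}} {E : EnvOfGroup S.toThetaSetting P}

/-- The composite `Π_v ≅ Π_X(M^Θ(Π_v)) ↠ G` of `EnvOfGroup` as ONE monoid homomorphism (its kernel is the `Δ` of
`PointedInversion`). [folklore] -/
private theorem projG_isoX_eq_iff_mul_inv (x b : P) :
    E.recon.projG (E.isoX b) = E.recon.projG (E.isoX x) ↔ E.recon.projG (E.isoX (x⁻¹ * b)) = 1 := by
  rw [map_mul, map_inv, map_mul, map_inv, inv_mul_eq_one, eq_comm]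

/-- **(SJ) from the surjectivity `Π^tp_{X,ℍ} ↠ G_k` of [IUTchI] Cor. 2.3 (iii)** (kurims [IUTchI] p. 47: "`Π^tp_{X,ℍ}`
… defined so as to render the sequences exact"; [IUTchII] Prop. 2.2 p. 66: `Π_{v•}` IS that group at `ℍ = Γ•_X`).
Given an L5 datum `C` whose `Π^tp_X` is identified with the reference group `Π^tp_{X̲̲_v}` by `j`, with
`j(Π^tp_{X,ℍ}) = Π^tp_{X,Γ•}` (`R.refBullet`), and an identification `e₀ : Π_v ≅ Π^tp_{X̲̲_v}` under which
`Ker(Π_v ↠ G) = Ker(Π^tp_X ↠ G_k)`: if `Π^tp_{X,ℍ} ↠ G_k` is surjective then every `x ∈ Π_v` is congruent modulo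
`Δ` to some `b` with `e₀ b ∈ Π^tp_{X,Γ•}` — the hypothesis `hsurj` of `prop22_i'_of_groupTheoretic`.
[claim: Mochizuki2012, status: disputed] (IUTchI §2 Cor 2.3 (iii), kurims p.47; IUTchII §2 Prop 2.2, kurims p.66) -/
theorem SubgraphReference.exists_mem_refBullet_of_piTpXH_surjective (R : SubgraphReference S)
    (C : StableCurveTemperedData.{u}) (j : C.PiTp ≃ₜ* S.PiX) (e₀ : P ≃ₜ* S.PiX)
    (hbullet : R.refBullet = C.piTpXH.map j.toMulEquiv.toMonoidHom)
    (hker : ∀ y : P, E.recon.projG (E.isoX y) = 1 ↔ C.prTp (j.symm (e₀ y)) = 1)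
    (hsurjC : Function.Surjective (C.prTp.comp C.piTpXH.subtype)) :
    ∃ e₀ : P ≃ₜ* S.PiX, ∀ x : P, ∃ b : P, e₀ b ∈ R.refBullet ∧
      E.recon.projG (E.isoX b) = E.recon.projG (E.isoX x) := by
  refine ⟨e₀, fun x => ?_⟩
  -- `g := j⁻¹(e₀ x) ∈ Π^tp_X`; pick `h ∈ Π^tp_{X,ℍ}` with the same image in `G_k`
  obtain ⟨h, hh⟩ := hsurjC (C.prTp (j.symm (e₀ x)))
  refine ⟨e₀.symm (j (h : C.PiTp)), ?_, ?_⟩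
  · rw [ContinuousMulEquiv.apply_symm_apply, hbullet]
    exact ⟨(h : C.PiTp), h.2, rfl⟩
  · rw [projG_isoX_eq_iff_mul_inv, hker, map_mul, map_inv, ContinuousMulEquiv.apply_symm_apply, map_mul,
      map_inv, ContinuousMulEquiv.symm_apply_apply, map_mul, map_inv]
    rw [MonoidHom.comp_apply, Subgroup.coe_subtype] at hh
    rw [hh, inv_mul_cancel]

/-- **(SJ) from the outer-descent hypothesis of [IUTchI] Cor. 2.3 (i)** ("the sub-semi-graph `ℍ ⊆ 𝔾` is stabilized
by the natural action of `G_k` on `𝔾`", kurims [IUTchI] p. 47, in the typed form consumed by abc-iut-w4-d058's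
`StableCurveTemperedData.piTpXH_surjective_of_outer`: every `Π^tp_X`-conjugate of `Δ^tp_{X,ℍ}` is a
`Δ^tp_X`-conjugate): then `Π^tp_{X,ℍ} ↠ G_k` (PROVED in L5, no slimness needed) and (SJ) follows by
`exists_mem_refBullet_of_piTpXH_surjective`. For `ℍ = Γ•_X` the stability holds because `Γ•_X` is `ι_X`-intrinsic
([IUTchII] Rmk. 2.1.1 (ii)) — supplied at the merge, not here.
[claim: Mochizuki2012, status: disputed] (IUTchI §2 Cor 2.3 (i)(iii), kurims p.47; IUTchII §2 Prop 2.2, kurims p.66) -/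
theorem SubgraphReference.exists_mem_refBullet_of_outer (R : SubgraphReference S)
    (C : StableCurveTemperedData.{u}) (j : C.PiTp ≃ₜ* S.PiX) (e₀ : P ≃ₜ* S.PiX)
    (hbullet : R.refBullet = C.piTpXH.map j.toMulEquiv.toMonoidHom)
    (hker : ∀ y : P, E.recon.projG (E.isoX y) = 1 ↔ C.prTp (j.symm (e₀ y)) = 1)
    (hOut : ∀ g : C.PiTp, ∃ d : C.DeltaTp, MulAut.conj g • (C.deltaTpH.map C.DeltaTp.subtype) =
      MulAut.conj (d : C.PiTp) • (C.deltaTpH.map C.DeltaTp.subtype)) :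
    ∃ e₀ : P ≃ₜ* S.PiX, ∀ x : P, ∃ b : P, e₀ b ∈ R.refBullet ∧
      E.recon.projG (E.isoX b) = E.recon.projG (E.isoX x) :=
  R.exists_mem_refBullet_of_piTpXH_surjective C j e₀ hbullet hker (C.piTpXH_surjective_of_outer hOut)

/-- **(SJ) from the typed [IUTchI] Cor. 2.3 (iii)** (`StableCurveTemperedData.Cor23iii`, abc-iut-L5-t1; its field
`exact_tp` = exactness of `1 → Δ^tp_{X,ℍ} → Π^tp_{X,ℍ} → G_k → 1`, second conjunct = the surjectivity) under the
hypothesis (a)/(b) of (iii) (`Cor23Hyp`; in the IUT application `Σ = {l}`, `Σ̂ = Primes`, so (a) holds,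
[IUTchII] Prop. 2.2 p. 66). [claim: Mochizuki2012, status: disputed]
(IUTchI §2 Cor 2.3 (iii), kurims p.47; IUTchII §2 Prop 2.2, kurims p.66) -/
theorem SubgraphReference.exists_mem_refBullet_of_cor23iii (R : SubgraphReference S)
    (C : StableCurveTemperedData.{u}) (j : C.PiTp ≃ₜ* S.PiX) (e₀ : P ≃ₜ* S.PiX)
    (hbullet : R.refBullet = C.piTpXH.map j.toMulEquiv.toMonoidHom)
    (hker : ∀ y : P, E.recon.projG (E.isoX y) = 1 ↔ C.prTp (j.symm (e₀ y)) = 1)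
    (h23 : C.Cor23iii) (hyp : C.Cor23Hyp) :
    ∃ e₀ : P ≃ₜ* S.PiX, ∀ x : P, ∃ b : P, e₀ b ∈ R.refBullet ∧
      E.recon.projG (E.isoX b) = E.recon.projG (E.isoX x) :=
  R.exists_mem_refBullet_of_piTpXH_surjective C j e₀ hbullet hker (h23.exact_tp hyp).2

/-- **IUTchII:Prop2.2(i)′ HOLDS given [IUTchI] Cor. 2.3 (iii) through the identification data** (kurims [IUTchII]
p. 66; composition with abc-iut-w4-d010's `prop22_i'_of_groupTheoretic`): inputs `R.GroupTheoretic` (the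
[SemiAnbd] Cor. 3.11 / [AbsTopI] Thm. 2.14 (i) input of the printed proof, p. 67), `Π_Ÿ(Π_v) ⊴ Π_v` (Rmk. 2.1.1 (i);
at the model abc-iut-L6-t1's `EtaleThetaDataOfSetting.piYdd_normal`), the L5 datum `C` of Cor. 2.3 at
`ℍ = Γ•_X` with the typed `Cor23iii` and hypothesis (a)/(b), and the identification binders `j`, `e₀`, `hbullet`,
`hker`. The printed normalisation "we may assume that … some representative of `ι` stabilizes `Π_{v•}` and `Π_{v▶}`"
is thus derived with (SJ) read off Cor. 2.3 (iii), not assumed. [claim: Mochizuki2012, status: disputed]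
(IUTchII §2 Prop 2.2 (i), kurims pp.66-67; IUTchI §2 Cor 2.3 (iii), kurims p.47) -/
theorem prop22_i'_of_cor23iii_bridge (R : SubgraphReference S) (T : TemperedCoverings S P)
    (D : EtaleThetaData S.toThetaSetting P) (ι₀ : PointedInversion E D) (hG : R.GroupTheoretic)
    (hN : D.PiYdd.Normal) (C : StableCurveTemperedData.{u}) (j : C.PiTp ≃ₜ* S.PiX) (e₀ : P ≃ₜ* S.PiX)
    (hbullet : R.refBullet = C.piTpXH.map j.toMulEquiv.toMonoidHom)
    (hker : ∀ y : P, E.recon.projG (E.isoX y) = 1 ↔ C.prTp (j.symm (e₀ y)) = 1)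
    (h23 : C.Cor23iii) (hyp : C.Cor23Hyp) :
    Prop22_i' R T D ι₀ :=
  prop22_i'_of_groupTheoretic R T D ι₀ hG hN (R.exists_mem_refBullet_of_cor23iii C j e₀ hbullet hker h23 hyp)

/-- **IUTchII:Prop2.2(i)′ HOLDS given the outer-descent form of [IUTchI] Cor. 2.3 (i)/(iii)** (the slimness-free
route: `ℍ = Γ•_X` is `G_k`-stable ⇒ `Π^tp_{X,ℍ} ↠ G_k` by abc-iut-w4-d058's `piTpXH_surjective_of_outer`), together
with `R.GroupTheoretic`, `Π_Ÿ(Π_v) ⊴ Π_v` and the identification binders. [claim: Mochizuki2012, status: disputed]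
(IUTchII §2 Prop 2.2 (i), kurims pp.66-67; IUTchI §2 Cor 2.3 (i)(iii), kurims p.47) -/
theorem prop22_i'_of_outer_bridge (R : SubgraphReference S) (T : TemperedCoverings S P)
    (D : EtaleThetaData S.toThetaSetting P) (ι₀ : PointedInversion E D) (hG : R.GroupTheoretic)
    (hN : D.PiYdd.Normal) (C : StableCurveTemperedData.{u}) (j : C.PiTp ≃ₜ* S.PiX) (e₀ : P ≃ₜ* S.PiX)
    (hbullet : R.refBullet = C.piTpXH.map j.toMulEquiv.toMonoidHom)
    (hker : ∀ y : P, E.recon.projG (E.isoX y) = 1 ↔ C.prTp (j.symm (e₀ y)) = 1)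
    (hOut : ∀ g : C.PiTp, ∃ d : C.DeltaTp, MulAut.conj g • (C.deltaTpH.map C.DeltaTp.subtype) =
      MulAut.conj (d : C.PiTp) • (C.deltaTpH.map C.DeltaTp.subtype)) :
    Prop22_i' R T D ι₀ :=
  prop22_i'_of_groupTheoretic R T D ι₀ hG hN (R.exists_mem_refBullet_of_outer C j e₀ hbullet hker hOut)

end Literature.IUT.HodgeArakelov
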